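import Mathlib
import HarnessLib
import Summits.Ventures.LatticeQCDFlow.Exactness.UniformKickDoubling
import Summits.Ventures.LatticeQCDFlow.Exactness.SymmetricMetropolis
import Summits.Ventures.LatticeQCDFlow.Exactness.InvariantComposition
import Summits.Ventures.LatticeQCDFlow.Exactness.RefreshScan
import Summits.Ventures.LatticeQCDFlow.Exactness.DoeblinUniqueness

/-!
# The N-hit random-walk Metropolis update of one `U(1)` link is Doeblin after enough hits, whatever the frozen environment

HONEST FRAMING: exact (Metropolis-corrected) sampling algorithms for lattice gauge theory;
figures of merit are autocorrelation/cost numbers at stated couplings and volumes; no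
continuum-physics claim.

Venture `LatticeQCDFlow` (cell pub-lqcd), topic `Exactness`, FANOUT row 9 (eng-latcore, the
engine `latflow.core.u1_2d.U1Field2D.sweep_metropolis(β, step, nhit)`: for each link, `nhit`
proposals `θ ← θ + step·U[−1,1]` accepted with `min(1, e^{−ΔS})`, the other links frozen).  NEW
WORK of the cell over Mathlib and the tree (`SymmetricMetropolis.lean`: `symMH`, `mulWalk`,
`mulWalkMH_invariant`; `InvariantComposition.lean`: `nHit`; `RefreshScan.lean`: `comp_minorised`,
`uniformlyErgodic_of_minorised`; `DoeblinUniqueness.lean`; `UniformKickDoubling.lean`: `2^j`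
box-uniform kicks cover `U(1)`; `U1ExpChartMinorisation.lean`); nothing here is cited as a fact.
Printed counterparts, named only: Metropolis et al. 1953, Meyn–Tweedie ch. 16.

* §1 (any state space) `le_imhAcceptE_of_bounds` — a weight pinched `0 < m ≤ p ≤ M` accepts every
  proposal with probability `≥ m/M`; **`smul_proposal_le_symMH`** — one Metropolis hit dominates
  `(m/M) ×` its proposal kernel; **`smul_nHit_le_nHit_symMH`** — `N` hits dominate `(m/M)^N ×` `N`
  proposals (`comp_minorised`).
* §2 (the circle) `convPow`, `convPow_add`, `convPow_two_pow` (`= convDouble`), `convPow_smul`;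
  **`nHit_mulWalk_map_exp`** — `N` multiplicative kicks `V ← e^{iθ}V`, `θ ∼ ν`, from `u` have the law
  `(ν^{∗N}) ∘ (θ ↦ e^{iθ}u)⁻¹`: on `U(1)` kicks commute, so the walk is the additive walk upstairs.
* §3 `u1KickLaw s` (the engine's proposal law: `e^{iθ}`, `θ` uniform on `|θ| < s`), inversion
  invariant (`isInvInvariant_u1KickLaw`), `u1LinkMetropolis s p = symMH (mulWalk (u1KickLaw s)) p`;
  **`u1LinkMetropolis_nHit_minorised`** — for every `s > 0` and measurable `p` with
  `0 < m ≤ p ≤ M` there are `N` and `δ > 0` with `(K^N)(u, ·) ≥ δ · Haar` from EVERY `u`;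
  **`u1LinkMetropolis_nHit_uniformlyErgodic`** — the `N`-hit chain converges to `Z⁻¹ p · Haar`
  geometrically from every start; **`u1LinkMetropolis_invariant_unique`** — `Z⁻¹ p · Haar` is the
  only probability law invariant under ONE hit (an invariant law of `K` is invariant under `K^N`).

For the engine: `p(θ) = e^{βR cos(θ − φ)}` (the link's conditional Wilson weight given its
staples) is pinched between `e^{−β|R|}` and `e^{β|R|}`, so the statement covers the inner loop of
`sweep_metropolis` at ANY `step > 0` once `nhit ≥ N(step)` (e.g. `N(1.0) = 8`: three doublings,
`(3/2)³ > π`).  NOT here: the bookkeeping across links and sweeps that gives a Doeblin minorant of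
the full sweep at the default `nhit = 4` (kicks to one link in different sweeps still commute on
the all-accept event; to be assembled as in `HeatBathSweepErgodic.lean`); `SU(2)` (non-commuting
kicks); any useful constant.
-/

noncomputable section

namespace Summit.Ventures.LatticeQCDFlow.Exactness

open MeasureTheory ProbabilityTheory ProbabilityTheory.Kernel Set Metric
open Literature.MathematicalPhysics.QuantumFieldTheory (haarProbability)
open scoped ENNReal

/-! ## §1 A pinched weight: each hit dominates a fixed multiple of its proposal -/

section Generic

variable {Ω : Type*} [MeasurableSpace Ω] {P : Kernel Ω Ω} [IsSFiniteKernel P] {p : Ω → ℝ} {m M : ℝ}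

omit [MeasurableSpace Ω] [IsSFiniteKernel P] in
/-- A weight pinched between `0 < m` and `M` accepts every proposal with probability `≥ m/M`. -/
theorem le_imhAcceptE_of_bounds (hm : 0 < m) (hpm : ∀ x, m ≤ p x) (hpM : ∀ x, p x ≤ M) (x y : Ω) :
    ENNReal.ofReal (m / M) ≤ imhAcceptE p x y := by
  unfold imhAcceptE imhAccept
  have hM : 0 < M := hm.trans_le ((hpm x).trans (hpM x))
  have hpx : 0 < p x := hm.trans_le (hpm x)
  refine ENNReal.ofReal_le_ofReal (le_min ?_ ?_)
  · exact (div_le_one hM).2 ((hpm x).trans (hpM x))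
  · rw [div_le_div_iff₀ hM hpx]
    nlinarith [hpm y, hpM x]

/-- **One Metropolis hit dominates `(m/M) ×` its proposal kernel** (pinched weight). -/
theorem smul_proposal_le_symMH (hp : Measurable p) (hm : 0 < m) (hpm : ∀ x, m ≤ p x)
    (hpM : ∀ x, p x ≤ M) (x : Ω) : ENNReal.ofReal (m / M) • P x ≤ symMH P p x := by
  refine Measure.le_iff.2 fun B hB => ?_
  rw [Measure.smul_apply, smul_eq_mul, symMH_apply hp x hB]
  calc ENNReal.ofReal (m / M) * P x B = ∫⁻ _ in B, ENNReal.ofReal (m / M) ∂(P x) := by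
        rw [MeasureTheory.setLIntegral_const, mul_comm]
    _ ≤ ∫⁻ y in B, imhAcceptE p x y ∂(P x) :=
        setLIntegral_mono ((measurable_imhAcceptE hp).comp measurable_prodMk_left)
          fun y _ => le_imhAcceptE_of_bounds hm hpm hpM x y
    _ ≤ _ := le_self_add

/-- **`N` hits dominate `(m/M)^N ×` `N` proposals.** -/
theorem smul_nHit_le_nHit_symMH (hp : Measurable p) (hm : 0 < m) (hpm : ∀ x, m ≤ p x)
    (hpM : ∀ x, p x ≤ M) : ∀ (N : ℕ) (x : Ω),
    ENNReal.ofReal (m / M) ^ N • nHit P N x ≤ nHit (symMH P p) N x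
  | 0, x => by simp
  | N + 1, x => by
      rw [nHit_succ, nHit_succ, pow_succ]
      exact comp_minorised (smul_nHit_le_nHit_symMH hp hm hpm hpM N)
        (smul_proposal_le_symMH hp hm hpm hpM) x

end Generic

/-! ## §2 On `U(1)` the multiplicative random walk is the additive walk upstairs -/

section CircleWalk

/-- The `n`-fold additive convolution power: `convPow μ 0 = δ₀`, `convPow μ (n+1) = μ ∗ convPow μ n`. -/
def convPow (μ : Measure ℝ) : ℕ → Measure ℝ
  | 0 => Measure.dirac 0
  | n + 1 => μ ∗ convPow μ n

/-- Convolution powers of an s-finite measure are s-finite. -/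
theorem sFinite_convPow (μ : Measure ℝ) [SFinite μ] : ∀ n, SFinite (convPow μ n)
  | 0 => by rw [convPow]; infer_instance
  | n + 1 => by
      haveI := sFinite_convPow μ n
      rw [convPow]
      infer_instance

/-- `convPow μ (a + b) = convPow μ a ∗ convPow μ b`. -/
theorem convPow_add (μ : Measure ℝ) [SFinite μ] (a b : ℕ) :
    convPow μ (a + b) = convPow μ a ∗ convPow μ b := by
  induction a with
  | zero =>
      haveI := sFinite_convPow μ b
      rw [Nat.zero_add, convPow, Measure.dirac_zero_conv]
  | succ a ih =>
      haveI := sFinite_convPow μ a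
      haveI := sFinite_convPow μ b
      haveI := sFinite_convPow μ (a + b)
      rw [Nat.succ_add, convPow, convPow, ih, Measure.conv_assoc]

/-- `convPow μ (2^j) = convDouble μ j`. -/
theorem convPow_two_pow (μ : Measure ℝ) [SFinite μ] : ∀ j : ℕ, convPow μ (2 ^ j) = convDouble μ j
  | 0 => by
      rw [pow_zero, convDouble, show (1 : ℕ) = 0 + 1 from rfl, convPow, convPow, Measure.conv_dirac_zero]
  | j + 1 => by
      rw [pow_succ, mul_two, convPow_add, convPow_two_pow μ j, convDouble]

/-- Scalars: `convPow (c • μ) n = c^n • convPow μ n`. -/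
theorem convPow_smul (μ : Measure ℝ) [SFinite μ] (c : ℝ≥0∞) (hc : c ≠ ⊤) :
    ∀ n : ℕ, convPow (c • μ) n = c ^ n • convPow μ n
  | 0 => by rw [convPow, convPow, pow_zero, one_smul]
  | n + 1 => by
      haveI := sFinite_convPow μ n
      rw [convPow, convPow, convPow_smul μ c hc n, smul_conv_smul, pow_succ']

/-- The law of `N` multiplicative kicks `V ← e^{iθ} V`, `θ ∼ ν` independent, started at `u`, is
the push-forward of the `N`-fold ADDITIVE convolution power of `ν` under `θ ↦ e^{iθ}·u` — on `U(1)`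
the kicks commute: `e^{iθ'}(e^{iθ}u) = e^{i(θ'+θ)}u`. -/
theorem nHit_mulWalk_map_exp (ν : Measure ℝ) [SFinite ν] :
    ∀ (N : ℕ) (u : Circle), nHit (mulWalk (ν.map Circle.exp)) N u =
      (convPow ν N).map (fun θ : ℝ => Circle.exp θ * u)
  | 0, u => by
      have hg : Measurable fun θ : ℝ => Circle.exp θ * u :=
        (Circle.exp.continuous.mul continuous_const).measurable
      rw [nHit_zero, Kernel.id_apply, convPow, Measure.map_dirac' hg, Circle.exp_zero, one_mul]
  | N + 1, u => by
      haveI := sFinite_convPow ν N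
      have hg : Measurable fun θ : ℝ => Circle.exp θ * u :=
        (Circle.exp.continuous.mul continuous_const).measurable
      rw [nHit_succ, Kernel.comp_apply, nHit_mulWalk_map_exp ν N u, convPow]
      ext B hB
      have hmw : ∀ w : Circle, mulWalk (ν.map Circle.exp) w B = ν {θ' : ℝ | Circle.exp θ' * w ∈ B} := by
        intro w
        have hS : MeasurableSet {θ' : ℝ | Circle.exp θ' * w ∈ B} :=
          hB.preimage ((Circle.exp.continuous.mul continuous_const).measurable)
        rw [← lintegral_indicator_one hB, lintegral_mulWalk _ w (measurable_one.indicator hB),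
          lintegral_map (show Measurable (fun X : Circle => B.indicator (1 : Circle → ℝ≥0∞) (X * w)) from
            (measurable_one.indicator hB).comp (measurable_mul_const w)) Circle.exp.continuous.measurable,
          ← lintegral_indicator_one hS]
        rfl
      rw [Measure.bind_apply hB (Kernel.aemeasurable _), lintegral_map (Kernel.measurable_coe _ hB) hg,
        Measure.map_apply hg hB, Measure.conv, Measure.map_apply measurable_add (hg hB),
        Measure.prod_apply_symm (measurable_add (hg hB))]
      refine lintegral_congr fun θ => ?_
      rw [hmw]
      congr 1
      ext θ'
      simp only [mem_setOf_eq, mem_preimage, Circle.exp_add, mul_assoc]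

end CircleWalk

/-! ## §3 The engine's `U(1)` link Metropolis: Doeblin after enough hits, uniformly in the environment -/

section U1Link

/-- **The engine's proposal law** on `U(1)`: `e^{iθ}` with `θ` uniform on `|θ| < s`
(`θ ← θ + step·U[−1,1]`, read through `θ ↦ e^{iθ}`). -/
def u1KickLaw (s : ℝ) : Measure Circle :=
  ((ENNReal.ofReal (2 * s))⁻¹ • volume.restrict (ball (0 : ℝ) s)).map Circle.exp

/-- The proposal law is a probability law for `s > 0`. -/
theorem isProbabilityMeasure_u1KickLaw {s : ℝ} (hs : 0 < s) : IsProbabilityMeasure (u1KickLaw s) := by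
  have h2s : ENNReal.ofReal (2 * s) ≠ 0 := by
    rw [Ne, ENNReal.ofReal_eq_zero, not_le]; positivity
  haveI : IsProbabilityMeasure ((ENNReal.ofReal (2 * s))⁻¹ • volume.restrict (ball (0 : ℝ) s)) :=
    ⟨by rw [Measure.smul_apply, Measure.restrict_apply_univ, Real.volume_ball, smul_eq_mul,
      ENNReal.inv_mul_cancel h2s ENNReal.ofReal_ne_top]⟩
  exact Measure.isProbabilityMeasure_map Circle.exp.continuous.measurable.aemeasurable

/-- Lebesgue measure on a centred interval is symmetric under `θ ↦ −θ`. -/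
theorem map_neg_restrict_ball (s : ℝ) :
    (volume.restrict (ball (0 : ℝ) s)).map (fun θ : ℝ => -θ) = volume.restrict (ball (0 : ℝ) s) := by
  have hpre : (fun θ : ℝ => -θ) ⁻¹' ball (0 : ℝ) s = ball 0 s := by
    ext θ; simp
  rw [← hpre, ← Measure.restrict_map measurable_neg measurableSet_ball, Measure.map_neg_eq_self, hpre]

/-- **The proposal law is inversion invariant** (`(e^{iθ})⁻¹ = e^{−iθ}` and the interval is
symmetric) — the symmetry hypothesis of `mulWalkMH_invariant`. -/
theorem isInvInvariant_u1KickLaw (s : ℝ) : (u1KickLaw s).IsInvInvariant := by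
  refine ⟨?_⟩
  rw [Measure.inv, u1KickLaw, Measure.map_map measurable_inv Circle.exp.continuous.measurable]
  have hcomp : (Inv.inv ∘ Circle.exp : ℝ → Circle) = Circle.exp ∘ fun θ : ℝ => -θ := by
    funext θ
    simp only [Function.comp_apply, Circle.exp_neg]
  rw [hcomp, ← Measure.map_map Circle.exp.continuous.measurable measurable_neg, Measure.map_smul,
    map_neg_restrict_ball]

/-- The proposal law is s-finite (needed to form the Metropolis kernel). -/
instance sFinite_u1KickLaw (s : ℝ) : SFinite (u1KickLaw s) := by
  unfold u1KickLaw; infer_instance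

/-- **The engine's `U(1)` link Metropolis hit**: propose `V ← e^{iθ} V`, `θ` uniform on `|θ| < s`,
accept with `min(1, p(V')/p(V))` (`p` = the link's conditional weight, the other links frozen). -/
def u1LinkMetropolis (s : ℝ) (p : Circle → ℝ) : Kernel Circle Circle :=
  symMH (mulWalk (u1KickLaw s)) p

variable {s : ℝ} {p : Circle → ℝ} {m M : ℝ}

/-- **DOEBLIN AFTER ENOUGH HITS, UNIFORMLY IN THE ENVIRONMENT.**  For every kick size `s > 0` and
every measurable weight pinched `0 < m ≤ p ≤ M` there are `N` and `δ > 0` with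
`(K^N)(u, ·) ≥ δ · Haar` from EVERY `u ∈ U(1)`, `K = u1LinkMetropolis s p`; `N` depends on `s`
only (`2^j` with `(3/2)^j s > π`), `δ` on `s, m/M` only. -/
theorem u1LinkMetropolis_nHit_minorised (hs : 0 < s) (hp : Measurable p) (hm : 0 < m)
    (hpm : ∀ x, m ≤ p x) (hpM : ∀ x, p x ≤ M) :
    ∃ N : ℕ, ∃ δ : ℝ≥0∞, 0 < δ ∧ ∀ u : Circle,
      δ • haarProbability Circle ≤ nHit (u1LinkMetropolis s p) N u := by
  obtain ⟨j, c, hc, hcov⟩ := exists_smul_haar_le_map_convDouble hs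
  have h2s : ENNReal.ofReal (2 * s) ≠ 0 := by
    rw [Ne, ENNReal.ofReal_eq_zero, not_le]; positivity
  have hinv : (ENNReal.ofReal (2 * s))⁻¹ ≠ ⊤ := ENNReal.inv_ne_top.2 h2s
  have hmM : ENNReal.ofReal (m / M) ≠ 0 := by
    rw [Ne, ENNReal.ofReal_eq_zero, not_le]
    exact div_pos hm (hm.trans_le ((hpm 1).trans (hpM 1)))
  refine ⟨2 ^ j, ENNReal.ofReal (m / M) ^ 2 ^ j * ((ENNReal.ofReal (2 * s))⁻¹ ^ 2 ^ j * c),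
    ENNReal.mul_pos (pow_ne_zero _ hmM) (mul_ne_zero (pow_ne_zero _ (ENNReal.inv_ne_zero.2
      ENNReal.ofReal_ne_top)) hc.ne'), fun u => ?_⟩
  have hwalk : ((ENNReal.ofReal (2 * s))⁻¹ ^ 2 ^ j * c) • haarProbability Circle ≤
      nHit (mulWalk (u1KickLaw s)) (2 ^ j) u := by
    rw [u1KickLaw, nHit_mulWalk_map_exp, convPow_smul _ _ hinv, convPow_two_pow, Measure.map_smul,
      mul_smul]
    exact measure_smul_le_smul_of_le (hcov u) _
  calc (ENNReal.ofReal (m / M) ^ 2 ^ j * ((ENNReal.ofReal (2 * s))⁻¹ ^ 2 ^ j * c)) • haarProbability Circle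
      = ENNReal.ofReal (m / M) ^ 2 ^ j •
          (((ENNReal.ofReal (2 * s))⁻¹ ^ 2 ^ j * c) • haarProbability Circle) := by rw [mul_smul]
    _ ≤ ENNReal.ofReal (m / M) ^ 2 ^ j • nHit (mulWalk (u1KickLaw s)) (2 ^ j) u :=
        measure_smul_le_smul_of_le hwalk _
    _ ≤ nHit (u1LinkMetropolis s p) (2 ^ j) u := by
        unfold u1LinkMetropolis
        exact smul_nHit_le_nHit_symMH hp hm hpm hpM (2 ^ j) u

/-- The target law `Z⁻¹ p · Haar` of the link Metropolis. -/
def u1LinkGibbs (p : Circle → ℝ) : Measure Circle :=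
  (((haarProbability Circle).withDensity fun u => ENNReal.ofReal (p u)) univ)⁻¹ •
    (haarProbability Circle).withDensity fun u => ENNReal.ofReal (p u)

/-- `Z⁻¹ p · Haar` is a probability law for a pinched weight. -/
theorem isProbabilityMeasure_u1LinkGibbs (hm : 0 < m) (hpm : ∀ x, m ≤ p x) (hpM : ∀ x, p x ≤ M) :
    IsProbabilityMeasure (u1LinkGibbs p) := by
  have hZ : ((haarProbability Circle).withDensity fun u => ENNReal.ofReal (p u)) univ ≠ 0 ∧
      ((haarProbability Circle).withDensity fun u => ENNReal.ofReal (p u)) univ ≠ ⊤ := by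
    rw [withDensity_apply _ MeasurableSet.univ, Measure.restrict_univ]
    constructor
    · intro h0
      have hle : ∫⁻ _u : Circle, ENNReal.ofReal m ∂(haarProbability Circle) ≤ 0 := by
        rw [← h0]
        exact lintegral_mono fun u => ENNReal.ofReal_le_ofReal (hpm u)
      rw [MeasureTheory.lintegral_const, measure_univ, mul_one, nonpos_iff_eq_zero, ENNReal.ofReal_eq_zero] at hle
      exact absurd hle (not_le.2 hm)
    · refine ne_top_of_le_ne_top (ENNReal.ofReal_ne_top (r := M)) ?_
      calc ∫⁻ u, ENNReal.ofReal (p u) ∂(haarProbability Circle)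
          ≤ ∫⁻ _u, ENNReal.ofReal M ∂(haarProbability Circle) :=
            lintegral_mono fun u => ENNReal.ofReal_le_ofReal (hpM u)
        _ = ENNReal.ofReal M := by rw [MeasureTheory.lintegral_const, measure_univ, mul_one]
  exact ⟨by rw [u1LinkGibbs, Measure.smul_apply, smul_eq_mul, ENNReal.inv_mul_cancel hZ.1 hZ.2]⟩

/-- One hit — hence `N` hits — leaves `Z⁻¹ p · Haar` invariant (`mulWalkMH_invariant`: left-invariant
Haar, inversion-invariant probability step law, positive measurable weight). -/
theorem u1LinkMetropolis_nHit_invariant (hs : 0 < s) (hp : Measurable p) (hp0 : ∀ u, 0 < p u) (N : ℕ) :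
    Kernel.Invariant (nHit (u1LinkMetropolis s p) N) (u1LinkGibbs p) := by
  haveI := isProbabilityMeasure_u1KickLaw hs
  haveI := isInvInvariant_u1KickLaw s
  unfold u1LinkGibbs u1LinkMetropolis
  exact invariant_smul (invariant_nHit (mulWalkMH_invariant (μ := haarProbability Circle) hp hp0) N) _

/-- **THE `N`-HIT `U(1)` LINK METROPOLIS IS UNIFORMLY ERGODIC.**  For `s > 0` and a measurable weight
with `0 < m ≤ p ≤ M`: with `N`, `δ` of `u1LinkMetropolis_nHit_minorised`,
`|μ₀(K^N)ᵗ(A) − (Z⁻¹p·Haar)(A)| ≤ (1 − δ)ᵗ` for every initial law `μ₀`, every `t`, every `A`. -/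
theorem u1LinkMetropolis_nHit_uniformlyErgodic (hs : 0 < s) (hp : Measurable p) (hm : 0 < m)
    (hpm : ∀ x, m ≤ p x) (hpM : ∀ x, p x ≤ M) :
    ∃ N : ℕ, ∃ δ : ℝ, 0 < δ ∧ δ ≤ 1 ∧ ∀ (μ₀ : Measure Circle) [IsProbabilityMeasure μ₀] (t : ℕ)
      (A : Set Circle),
      |((fun ν : Measure Circle => ν.bind (nHit (u1LinkMetropolis s p) N))^[t] μ₀).real A
          - (u1LinkGibbs p).real A| ≤ (1 - δ) ^ t := by
  obtain ⟨N, δ, hδ0, hmin⟩ := u1LinkMetropolis_nHit_minorised hs hp hm hpm hpM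
  haveI := isProbabilityMeasure_u1KickLaw hs
  haveI := isProbabilityMeasure_u1LinkGibbs hm hpm hpM
  haveI : Fact (Measurable p) := ⟨hp⟩
  haveI : IsMarkovKernel (u1LinkMetropolis s p) := by unfold u1LinkMetropolis; infer_instance
  haveI : IsMarkovKernel (nHit (u1LinkMetropolis s p) N) := by
    clear hmin
    induction N with
    | zero => rw [nHit_zero]; infer_instance
    | succ n ih => rw [nHit_succ]; haveI := ih; infer_instance
  have hp0 : ∀ u, 0 < p u := fun u => hm.trans_le (hpm u)
  have hδ1 : δ ≤ 1 := by
    have h := Measure.le_iff'.1 (hmin 1) univ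
    rwa [Measure.smul_apply, smul_eq_mul, measure_univ, measure_univ, mul_one] at h
  have hδtop : δ ≠ ⊤ := ne_top_of_le_ne_top ENNReal.one_ne_top hδ1
  refine ⟨N, δ.toReal, ENNReal.toReal_pos hδ0.ne' hδtop,
    ENNReal.toReal_le_of_le_ofReal zero_le_one (by rwa [ENNReal.ofReal_one]), fun μ₀ _ t A => ?_⟩
  exact uniformlyErgodic_of_minorised hmin (u1LinkMetropolis_nHit_invariant hs hp hp0 N) μ₀ t A

/-- **`Z⁻¹ p · Haar` is the only probability law invariant under ONE hit** of the `U(1)` link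
Metropolis (an invariant law of `K` is invariant under `K^N`, which is Doeblin). -/
theorem u1LinkMetropolis_invariant_unique (hs : 0 < s) (hp : Measurable p) (hm : 0 < m)
    (hpm : ∀ x, m ≤ p x) (hpM : ∀ x, p x ≤ M) {π' : Measure Circle} [IsProbabilityMeasure π']
    (hπ' : Kernel.Invariant (u1LinkMetropolis s p) π') : π' = u1LinkGibbs p := by
  obtain ⟨N, δ, hδ0, hmin⟩ := u1LinkMetropolis_nHit_minorised hs hp hm hpm hpM
  haveI := isProbabilityMeasure_u1KickLaw hs
  haveI := isProbabilityMeasure_u1LinkGibbs hm hpm hpM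
  haveI : Fact (Measurable p) := ⟨hp⟩
  haveI : IsMarkovKernel (u1LinkMetropolis s p) := by unfold u1LinkMetropolis; infer_instance
  haveI : IsMarkovKernel (nHit (u1LinkMetropolis s p) N) := by
    clear hmin
    induction N with
    | zero => rw [nHit_zero]; infer_instance
    | succ n ih => rw [nHit_succ]; haveI := ih; infer_instance
  have hp0 : ∀ u, 0 < p u := fun u => hm.trans_le (hpm u)
  exact invariant_unique_of_minorised hmin hδ0 (u1LinkMetropolis_nHit_invariant hs hp hp0 N)
    (invariant_nHit hπ' N)

end U1Link



end Summit.Ventures.LatticeQCDFlow.Exactness
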